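import Summits.QuantumFields.QCD.Theorems.QuarksAsStableActionCriticalLineDiamagnetismCheckerEvalDefs

/-!
# Block-margin certificate of region 0 (P0) (crux stmt-QuantumFields-9734, line `Sketch`, lead c3)

The COMPUTATION: the root box(es) `roots 0` of region `0` pass the adaptive bisection driver with the affine leaf
test at `γ = 3 / 2500` and fuel `60` (`certifyRegion`, evaluated by `native_decide`; ≈ 3–9·10³ leaves, a few minutes).
With `region_sound` (`…CheckerEvalSoundB.lean`) this gives `BlockMargin 3 / 2500 C s` for every `C` of region `0` and every
class `s`, and hence `stub_blockMargin0` (`…StubBlockMargin0.lean`). Computational proof (`native_decide`).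
-/

namespace Summit.QuantumFields.QCD.Cruxes.CriticalLineDiamagnetism.ChessboardCellGain.Checker

/-- **Certificate of region 0** (registered helper `stub_checkerCert0`; computational). -/
theorem stub_checkerCert0 : certifyRegion (3 / 2500) 60 0 = true := by
  native_decide

end Summit.QuantumFields.QCD.Cruxes.CriticalLineDiamagnetism.ChessboardCellGain.Checker
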